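import Summits.HodgeConjecture.HodgeConjecture.Theorems.F0P2tLineRallisIdentity            -- ★ (N3) Rallis (26) for `lineThetaKernelDatum`, hypothesis-free
import Summits.HodgeConjecture.HodgeConjecture.Theorems.F0P2tLineFinCoeff                 -- ★ (N2) `exists_finCoeff_ne_zero_lineThetaKernelDatum` (hfin, every `χ_f`)
import Summits.HodgeConjecture.HodgeConjecture.Theorems.H413ThetaPairRepArchFinFactorisation  -- ★ brick 7 with `hω` discharged: `thetaLift_charCM_tmul_ne_zero_of_finCoeff_ne_zero`
import Literature.NumberTheory.Automorphic.Liu2021.Def411ChiAutomorphicQuotient            -- ★ `chiQuot`, `conj_coe_chiQuot_mk`, `continuous_lineChar`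
import Literature.NumberTheory.Automorphic.Liu2021.Def411WeilCarriersChiUnitary            -- ★ `norm_lineChar_apply_eq_one_cm`
import Literature.NumberTheory.Automorphic.Liu2021.ThetaLiftFromLineMeets                  -- ★ `lineThetaKernelDatum`
import Literature.NumberTheory.Automorphic.Liu2021.ThetaLiftFromLineCharacters             -- ★ `compactSpace_quotient_range_toAdelic_JW`, `normal_range_toAdelic_JW`
import Literature.NumberTheory.Automorphic.Liu2021.ThetaLiftFromLineFrame                   -- ★ `cmAdelicFrameTransport`
import Literature.NumberTheory.GelbartRogawski1991.UnitaryDualPairThetaLiftGaussianCharacter  -- ★ `exists_smulInvariantMeasure_quotient_range_toAdelic`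
import Literature.NumberTheory.Weil1964.AdelicMetaplecticReindex                           -- ★ `piSBReindex_tmul`
import Literature.NumberTheory.Automorphic.AdelicPiSchwartzBruhatFourier                   -- ★ `exists_haar_eq_smul_map_prod`
import Literature.NumberTheory.Automorphic.UnitaryGroupArchCompactTotallyComplex           -- ★ `UnitaryGroup.compactSpace_arch_rankOne`
import Literature.NumberTheory.Automorphic.UnitaryGroupRationalDiscrete                    -- ★ `UnitaryGroup.isHaarMeasure_map_finPart`
import Literature.NumberTheory.Automorphic.AdelicSecondCountable
import Literature.NumberTheory.Automorphic.AdicCompletionCompact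
import HarnessLib

/-!
# Crux `H413`, programme P2 — Θ-OCC-GEN road, brick (N4) = THE (N)-HALF: the global theta lift `Θ_{Φ_∞ ⊗ Φ_f}(χ̃_χ)` of the line `⟨a⟩` at the
# `μ`-splitting (T5 datum `lineThetaKernelDatum`) is NON-ZERO for some finite `Φ_f`, as soon as the archimedean vector `Φ_∞ ≠ 0` is FIXED by
# `U(⟨a⟩)(L⁺ ⊗ ℝ)` under the archimedean Weil representation — [Liu2021, Prop. 4.13 «Conversely» (Rallis inner product formula)] in function currency

Cell hodgecm-mathlib (D-0151), FLOOR 0, crux item H413 = stmt-HodgeConjecture-24833; programme P2, sub-line `Cruxes/H413/Lines/F0_P2OccFlatGeneral.lean`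
ED. 1 (Θ-OCC-GEN `stub_thetaOccursInGen`, books #173).  Author F0P2-p06 (g8), the (N)-half of the desk's (N)+(T-arch) split (P2 PLAN v13 ERRATUM 3 §E3.4 B2;
F0P2-p01 (g11)'s ★ junction `Theorems/F0P2sThetaOccursInOfArch` leaves exactly (T-arch) «(W)(K)(H) for the harmonic pair» and (N) «one theta pair ≠ 0»).
`--supports stmt-HodgeConjecture-24833`.  DEF-FREE, theorems only, no `sorry`.

THE POINT (print: [Liu2021, proof of Prop. 4.13, p. 49 «Conversely, … by the Rallis inner product formula, Θ(π_W) is contained in L²_disc(G)» and ≠ 0];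
[Li1992, Thm 2.1 (26)–(27), §5]).  By Rallis' identity (26) — a THEOREM of the tree for the T5 datum, ★ (N3) `F0P2tLineRallisIdentity.rallisInnerProductIdentity_lineThetaKernelDatum`
over the E-2 Siegel–Weil road — the Petersson norm of `Θ_{Φ_∞ ⊗ Φ_f}(χ̃)` is a positive multiple of `∫_{U(W)(𝔸)} ⟨ω(h)(Φ_∞ ⊗ Φ_f), Φ_∞ ⊗ Φ_f⟩ · conj χ̃(h) dh`, which
factors `∞ ⊔ f` (★ brick 7 `ThetaNonvanishing.thetaLift_charCM_tmul_ne_zero_of_finCoeff_ne_zero`, the pure-tensor factorisation `hω` discharged there for every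
compatible splitting): the archimedean factor is `vol · ‖Φ_∞‖² ≠ 0` when `Φ_∞` is an `ω_∞`-eigenvector of eigencharacter `χ̃_∞ = 1` (Liu's `χ̃` has TRIVIAL archimedean
component, ★ `conj_coe_chiQuot_mk`), i.e. FIXED by `U(W)(L⁺ ⊗ ℝ)`; the finite factor is non-zero for a suitable `Φ_f` for EVERY continuous unitary `χ_f` (local occupancy,
★ (N2) `F0P2tLineFinCoeff.exists_finCoeff_ne_zero_lineThetaKernelDatum` at `χ_f := χ_W = lineChar a χ`).  All reference choices (measures, Borel structures) are made
inside; the statement speaks of the CALLER's finite invariant open-positive measure `μ_W` on `[U(J_W a)]`.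

* **`lineThetaLift_tmul_charCM_chiQuot_ne_zero_of_archFixed`** — T5 frame `(L, N, e₁ : Fin N × Fin 1 ≃ Fin n', dV, μ conjugate-symplectic, a)`, `2 < N`, `3 ≤ n'`,
  sign facts `(ι₁, h₁V, hV)` on `d_V` and one complex embedding `τ` with all `re τ(d_V i) > 0`, Weil's majorants `hρ` (★ (N0) produces them), `μ_W` finite invariant open-positive,
  `χ ∈ Chi`; for every archimedean Schwartz vector `Φ_∞ ≠ 0` with **(E) `∀ a', archWeilRep … (chiSplittingLine …) … (1, a') Φ_∞ = Φ_∞`**: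
  `∃ Φ_f, (lineThetaKernelDatum …).thetaLift μ_W (piSchwartzBruhatEquiv L⁺ (Fin n') (Φ_∞ ⊗ₜ Φ_f)) (charCM χ̃_χ) ≠ 0`.
* **`exists_lineThetaLiftFun_piSBReindex_ne_zero_of_archFixed`** — the same in the junction's currency (★ `F0P2sThetaOccursInOfArch`, hypothesis `hN`): for
  `φ : 𝓢(((Fin N × Fin 1) → (L⁺ ⊗ ℝ)), ℂ)` with `R_e^∞ φ ≠ 0` fixed as in (E), `∃ Φ_f : FinSB L⁺ (Fin N × Fin 1)` and `x : U(H)(𝔸_{L⁺})` with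
  `Θ̃_{R_e(φ ⊗ Φ_f)}(charCM χ̃_χ)(ι_A x) ≠ 0` (★ `piSBReindex_tmul`; `ι_A = cmAdelicFrameTransport` is onto).

WHAT IS LEFT of Θ-OCC-GEN after (N0)–(N4) and p01's junction: the ARCHIMEDEAN vector — a pair `φ₀, φ₁` of archimedean Schwartz vectors, `U(W)_∞`-fixed under
`archWeilRep` at the `μ`-splitting (E), non-zero, whose theta pairs satisfy (W)(K)(H) ([KonnoKonno2007, Thm 5.4] ∕ [Liu2021, Lem. D.2]: the harmonic Gaussian of the admissible
line) — and the sign facts `(h₁V, hV)` of the OCC♭-GEN frame `(H, T, hT, hpos, g, hg)`.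
HONEST LABEL: HC_CM is proved only modulo the 2 remaining named inputs (hLiu418, h413) until rung 0 closes; this file asserts nothing of print.

## References
* [Liu2021] Y. Liu, Camb. J. Math. 9 (2021) = arXiv:2102.11518: proof of Prop. 4.13 (p. 49 «Conversely», l. 2145); Def. 4.11; App. D §D.1 Steps 1–3, Lem. D.2.
* [Li1992] J.-S. Li, J. reine angew. Math. 428 (1992), p. 178, Thm 2.1 (26)–(27) p. 184, §5.
* [GelbartRogawski1991] S. Gelbart, J. Rogawski, Invent. Math. 105 (1991), §3.1 Prop. 3.1.1 p. 455, Remark p. 457.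
* [Weil1964] A. Weil, Acta Math. 111 (1964), Chap. III n° 37–41.  [KonnoKonno2007] T. Konno, K. Konno, Kyushu J. Math. 61 (2007), Thm 5.4.
-/

set_option autoImplicit false
set_option linter.dupNamespace false

noncomputable section

open scoped ComplexConjugate Matrix ComplexOrder TensorProduct SchwartzMap NNReal Classical
open MeasureTheory MeasureTheory.Measure NumberField NumberField.InfinitePlace NumberField.mixedEmbedding IsDedekindDomain
open Literature.NumberTheory.Automorphic Literature.NumberTheory.Automorphic.UnitaryGroup
open Literature.NumberTheory.Automorphic.IdeleClassGroup
open Literature.NumberTheory.Automorphic.Liu2021 Literature.NumberTheory.Automorphic.Liu2021.Def411WeilCarriers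
open Literature.NumberTheory.Automorphic.Liu2021.Def411WeilCarriersDoubling
open Literature.NumberTheory.Weil1964 Literature.NumberTheory.Li1992
open Literature.NumberTheory.GelbartRogawski1991 Literature.NumberTheory.GelbartRogawski1991.UnitaryDualPair
open Literature.NumberTheory.GelbartRogawski1991.UnitaryDualPair.WeilCoinv
open Literature.NumberTheory.GaloisRepresentations (HeckeCharacter)
open Literature.RepresentationTheory.HarrisKudlaSweet1996 (IsSplittingChar)
open Literature.RepresentationTheory.Liu2021
open Literature.RepresentationTheory.CompactGroups (charCM)
open Summit.HodgeConjecture.HodgeConjecture.Cruxes.H413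

namespace Summit.HodgeConjecture.HodgeConjecture.Cruxes.H413.F0P2tLineThetaLiftNeZeroOfArchFixed

/-! ## §0 A non-zero archimedean Schwartz vector has non-zero `L²`-mass -/

section Mass

variable {X : Type*} [NormedAddCommGroup X] [NormedSpace ℝ X] [FiniteDimensional ℝ X] [MeasurableSpace X] [BorelSpace X]
  (μ : Measure X) [μ.IsAddHaarMeasure]

/-- for a non-zero Schwartz function `Φ` and an additive Haar measure `μ`, `∫ Φ · conj Φ dμ ≠ 0` (the integrand is `‖Φ‖² ≥ 0`, continuous, integrable, and
positive on the non-empty open support of `Φ`; same proof as ★ `ThetaDistAtLine.integral_mul_conj_ne_zero_of_ne_zero`, restated here so that this module stays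
in the T5 import cone). [folklore] -/
private theorem integral_mul_conj_ne_zero_of_ne_zero' (Φ : 𝓢(X, ℂ)) (hΦ : Φ ≠ 0) :
    ∫ x, Φ x * conj (Φ x) ∂μ ≠ 0 := by
  have hf : (fun x => Φ x * conj (Φ x)) = fun x => ((‖Φ x‖ ^ 2 : ℝ) : ℂ) := by
    funext x
    rw [Complex.mul_conj, Complex.normSq_eq_norm_sq]
  rw [hf, integral_complex_ofReal, Complex.ofReal_ne_zero]
  have hint : Integrable (fun x => ‖Φ x‖ ^ 2) μ := by
    have h1 : Integrable (fun x => ‖Φ x‖) μ := Φ.integrable.norm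
    have h2 : Integrable (fun x => ‖Φ x‖ * ‖Φ x‖) μ :=
      h1.bdd_mul h1.aestronglyMeasurable (Filter.Eventually.of_forall fun x => by
        rw [Real.norm_eq_abs, abs_norm]
        exact SchwartzMap.norm_le_seminorm ℝ Φ x)
    exact h2.congr (Filter.Eventually.of_forall fun x => by simp only [sq])
  have hpos : 0 < ∫ x, ‖Φ x‖ ^ 2 ∂μ := by
    rw [integral_pos_iff_support_of_nonneg (fun x => sq_nonneg _) hint]
    have hsupp : Function.support (fun x => ‖Φ x‖ ^ 2) = Function.support Φ := by
      ext x
      simp only [Function.mem_support, ne_eq, pow_eq_zero_iff (two_ne_zero), norm_eq_zero]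
    rw [hsupp]
    obtain ⟨x₀, hx₀⟩ : ∃ x₀, Φ x₀ ≠ 0 := by
      by_contra h
      exact hΦ (SchwartzMap.ext fun x => not_not.mp (not_exists.mp h x))
    exact (Φ.continuous.isOpen_support).measure_pos μ ⟨x₀, hx₀⟩
  exact hpos.ne'

end Mass

/-! ## §1 Positive definiteness of `diag d_V` through an embedding from the sign fact -/

/-- through a complex embedding `τ` at which all the (conjugation-fixed, hence real) `τ(d_V i)` are positive, `(diag d_V)^τ` is positive definite (the `(τ, hτ)` binder of the
CM Rallis letter). [cite: Liu2021, §4.3] [cite: Li1992, Thm 2.1 p. 184] -/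
theorem posDef_diagonal_map_of_re_pos (L : Type) [Field L] [NumberField L] [IsCMField L] {N : ℕ} (dV : Fin N → L)
    (hdV : ∀ i, IsCMField.complexConj L (dV i) = dV i) (τ : L →+* ℂ) (hτ : ∀ i, 0 < (τ (dV i)).re) :
    ((Matrix.diagonal dV).map τ).PosDef := by
  rw [Matrix.diagonal_map (map_zero τ)]
  refine Matrix.posDef_diagonal_iff.mpr fun i => Complex.pos_iff.mpr ⟨hτ i, ?_⟩
  have h := embedding_algebraMap_eq_embedding_of_isReal L
    ⟨(InfinitePlace.mk τ).comap (algebraMap (↥(maximalRealSubfield L)) L), IsTotallyReal.isReal _⟩ τ rfl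
    ⟨dV i, (IsCMField.complexConj_eq_self_iff (K := L) (dV i)).1 (hdV i)⟩
  change τ (dV i) = _ at h
  rw [h, Complex.ofReal_im]

/-- the adelic frame transport `ι_A = cmAdelicFrameTransport` is onto (a composite of two `≃ₜ*`). [folklore] -/
private theorem cmAdelicFrameTransport_surjective (L : Type) [Field L] [NumberField L] [IsCMField L] {N : ℕ} (dV : Fin N → L)
    (H : Matrix (Fin N) (Fin N) L) (g : GL (Fin N) L)
    (hg : ((g : Matrix (Fin N) (Fin N) L).map (cmConjRingHom L))ᵀ * H * (g : Matrix (Fin N) (Fin N) L) = Matrix.diagonal dV) :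
    Function.Surjective (cmAdelicFrameTransport L N H dV g hg) := fun y =>
  ⟨cmAdelicEquiv L N H ((cmFrameEquiv L g H dV hg).symm y), by
    show (cmFrameEquiv L g H dV hg) ((cmAdelicEquiv L N H).symm (cmAdelicEquiv L N H ((cmFrameEquiv L g H dV hg).symm y))) = y
    rw [ContinuousMulEquiv.symm_apply_apply, ContinuousMulEquiv.apply_symm_apply]⟩

/-! ## §2 The (N)-half: `Θ_{Φ_∞ ⊗ Φ_f}(χ̃_χ) ≠ 0` for an arch-fixed `Φ_∞ ≠ 0` and a suitable `Φ_f` -/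

variable (L : Type) [Field L] [NumberField L] [IsCMField L] {N n' : ℕ} (e₁ : Fin N × Fin 1 ≃ Fin n')
  (dV : Fin N → L) (hdV : ∀ i, IsCMField.complexConj L (dV i) = dV i) (hdV0 : ∀ i, dV i ≠ 0)
  (hN : 2 < N) (h3 : 3 ≤ n')
  (μH : Literature.NumberTheory.Automorphic.IdeleClassGroup L →ₜ* Circle) (hμ : IsConjugateSymplectic L μH)
  (a : (↥(maximalRealSubfield L))ˣ) (ι₁ : L →+* ℂ)
  (h₁V : ∃ i₀ : Fin N, (∀ i, i ≠ i₀ → 0 < (ι₁ (dV i)).re) ∨ ∀ i, i ≠ i₀ → (ι₁ (dV i)).re < 0)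
  (hV : ∀ τ : L →+* ℂ, InfinitePlace.mk τ ≠ InfinitePlace.mk ι₁ → (∀ i, 0 < (τ (dV i)).re) ∨ ∀ i, (τ (dV i)).re < 0)
  (τ : L →+* ℂ) (hτ : ∀ i, 0 < (τ (dV i)).re)
  (hρ : HasThetaMajorants fun
      (p : ↥(UnitaryGroup.adelic (↥(maximalRealSubfield L)) L (IsCMField.complexConj L) N (Matrix.diagonal dV)) ×
        ↥(UnitaryGroup.adelic (↥(maximalRealSubfield L)) L (IsCMField.complexConj L) 1 (JW (↥(maximalRealSubfield L)) L a)))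
      (Φ : piSchwartzBruhat (↥(maximalRealSubfield L)) (Fin n')) =>
        pairRep (↥(maximalRealSubfield L)) L (IsCMField.complexConj L) N 1 e₁ (Matrix.diagonal dV) (JW (↥(maximalRealSubfield L)) L a)
          (chiSplittingLine L e₁ dV hdV hdV0 (toHeckeCharacter L μH) (isUnitary_toHeckeCharacter L μH)
            ((isOscillatorChar_toHeckeCharacter_iff μH).mpr hμ) (TW (↥(maximalRealSubfield L)) a)
            (isUnit_det_TW (↥(maximalRealSubfield L)) a) (JW (↥(maximalRealSubfield L)) L a) (JW_eq (↥(maximalRealSubfield L)) L a))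
          p Φ)
  [CompactSpace (↥(UnitaryGroup.adelic (↥(maximalRealSubfield L)) L (IsCMField.complexConj L) N (Matrix.diagonal dV)) ⧸
    (UnitaryGroup.toAdelic (↥(maximalRealSubfield L)) L (IsCMField.complexConj L) N (Matrix.diagonal dV)).range)]
  [(UnitaryGroup.toAdelic (↥(maximalRealSubfield L)) L (IsCMField.complexConj L) 1 (JW (↥(maximalRealSubfield L)) L a)).range.Normal]
  [MeasurableSpace (↥(UnitaryGroup.adelic (↥(maximalRealSubfield L)) L (IsCMField.complexConj L) 1 (JW (↥(maximalRealSubfield L)) L a)) ⧸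
    (UnitaryGroup.toAdelic (↥(maximalRealSubfield L)) L (IsCMField.complexConj L) 1 (JW (↥(maximalRealSubfield L)) L a)).range)]
  [BorelSpace (↥(UnitaryGroup.adelic (↥(maximalRealSubfield L)) L (IsCMField.complexConj L) 1 (JW (↥(maximalRealSubfield L)) L a)) ⧸
    (UnitaryGroup.toAdelic (↥(maximalRealSubfield L)) L (IsCMField.complexConj L) 1 (JW (↥(maximalRealSubfield L)) L a)).range)]
  (μW : Measure (↥(UnitaryGroup.adelic (↥(maximalRealSubfield L)) L (IsCMField.complexConj L) 1 (JW (↥(maximalRealSubfield L)) L a)) ⧸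
    (UnitaryGroup.toAdelic (↥(maximalRealSubfield L)) L (IsCMField.complexConj L) 1 (JW (↥(maximalRealSubfield L)) L a)).range))
  [IsFiniteMeasure μW] [μW.IsOpenPosMeasure]
  [SMulInvariantMeasure ↥(UnitaryGroup.adelic (↥(maximalRealSubfield L)) L (IsCMField.complexConj L) 1 (JW (↥(maximalRealSubfield L)) L a))
    (↥(UnitaryGroup.adelic (↥(maximalRealSubfield L)) L (IsCMField.complexConj L) 1 (JW (↥(maximalRealSubfield L)) L a)) ⧸
      (UnitaryGroup.toAdelic (↥(maximalRealSubfield L)) L (IsCMField.complexConj L) 1 (JW (↥(maximalRealSubfield L)) L a)).range) μW]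
  (χ : Chi (↥(maximalRealSubfield L)) L (IsCMField.complexConj L))

set_option synthInstance.maxHeartbeats 400000 in
set_option maxHeartbeats 8000000 in
-- heartbeats: the brick-7 telescope at the `splittingDatum` of the line (cf. ★ `pin_thetaLift_charCM_ne_zero`, 8 000 000).
include hN h3 ι₁ h₁V hV τ hτ in
/-- **THE (N)-HALF OF Θ-OCC-GEN — `Θ_{Φ_∞ ⊗ Φ_f}(χ̃_χ) ≠ 0` FOR AN ARCH-FIXED `Φ_∞ ≠ 0` AND A SUITABLE `Φ_f`.**  See the module docstring.  Inputs: the T5 frame, `2 < N`,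
`3 ≤ n'`, the sign facts `(ι₁, h₁V, hV)` on `d_V`, an embedding `τ` with all `re τ(d_V i) > 0` (any place off `ι₁` of a frame definite off `ι₁`), Weil's majorants `hρ`, a finite invariant open-positive `μ_W` on `[U(J_W a)]`,
`χ ∈ Chi`, an archimedean Schwartz vector `Φ_∞ ≠ 0` with (E) `archWeilRep … (1, a') Φ_∞ = Φ_∞` for all `a' ∈ U(J_W a)(L⁺ ⊗ ℝ)`.
[cite: Liu2021, proof of Prop. 4.13 (p. 49 «Conversely», l. 2145); App. D §D.1 Step 3] [cite: Li1992, p. 178, Thm 2.1 (26)–(27) p. 184; §5]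
[cite: GelbartRogawski1991, §3.1 Prop. 3.1.1 p. 455, Remark p. 457] -/
theorem lineThetaLift_tmul_charCM_chiQuot_ne_zero_of_archFixed
    {Φinf : 𝓢((Fin n' → NumberField.mixedEmbedding.mixedSpace (↥(maximalRealSubfield L))), ℂ)} (hΦ : Φinf ≠ 0)
    (hE : ∀ a' : UnitaryGroup.arch (↥(maximalRealSubfield L)) L (IsCMField.complexConj L) 1 (JW (↥(maximalRealSubfield L)) L a),
      HodgeCM.Model.HypCensus.archWeilRep (↥(maximalRealSubfield L)) L (IsCMField.complexConj L) N 1 (Matrix.diagonal dV)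
        (JW (↥(maximalRealSubfield L)) L a) (complexConj_imagUnit L) (imagUnit_ne_zero L) (imagUnit_mul_self L) (realDiagonal_isSymm L dV hdV)
        (isSymm_TW (↥(maximalRealSubfield L)) a) (isUnit_det_realDiagonal L dV hdV hdV0) (isUnit_det_TW (↥(maximalRealSubfield L)) a)
        (realDiagonal_map L dV hdV).symm (JW_eq (↥(maximalRealSubfield L)) L a) e₁
        (chiSplittingLine L e₁ dV hdV hdV0 (toHeckeCharacter L μH) (isUnitary_toHeckeCharacter L μH)
          ((isOscillatorChar_toHeckeCharacter_iff μH).mpr hμ) (TW (↥(maximalRealSubfield L)) a)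
          (isUnit_det_TW (↥(maximalRealSubfield L)) a) (JW (↥(maximalRealSubfield L)) L a) (JW_eq (↥(maximalRealSubfield L)) L a))
        (ThetaNonvanishing.proj_apply_eq_toSp (↥(maximalRealSubfield L)) L (IsCMField.complexConj L) N 1 e₁ (Matrix.diagonal dV)
          (JW (↥(maximalRealSubfield L)) L a) (complexConj_imagUnit L) (imagUnit_ne_zero L) (imagUnit_mul_self L) (realDiagonal_isSymm L dV hdV)
          (isSymm_TW (↥(maximalRealSubfield L)) a) (isUnit_det_realDiagonal L dV hdV hdV0) (isUnit_det_TW (↥(maximalRealSubfield L)) a)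
          (realDiagonal_map L dV hdV).symm (JW_eq (↥(maximalRealSubfield L)) L a)
          (isCompatible_chiSplittingLine L e₁ dV hdV hdV0 (toHeckeCharacter L μH) (isUnitary_toHeckeCharacter L μH)
            ((isOscillatorChar_toHeckeCharacter_iff μH).mpr hμ) (TW (↥(maximalRealSubfield L)) a) (isSymm_TW (↥(maximalRealSubfield L)) a)
            (isUnit_det_TW (↥(maximalRealSubfield L)) a) (JW (↥(maximalRealSubfield L)) L a) (JW_eq (↥(maximalRealSubfield L)) L a)))
        (1, a') Φinf = Φinf) :
    ∃ Φf : FinSB (↥(maximalRealSubfield L)) (Fin n'),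
      (lineThetaKernelDatum L N e₁ dV hdV hdV0 μH hμ a hρ).thetaLift μW
          (piSchwartzBruhatEquiv (↥(maximalRealSubfield L)) (Fin n') (Φinf ⊗ₜ[ℂ] Φf))
          (charCM (chiQuot (↥(maximalRealSubfield L)) L (IsCMField.complexConj L) (Algebra.IsQuadraticExtension.finrank_eq_two _ L)
            (IsCMField.complexConj_ne_one (K := L)) a χ)) ≠ 0 := by
  -- (1) σ-algebras: Borel everywhere
  haveI := Literature.NumberTheory.Automorphic.secondCountableTopology_adeleRing (↥(maximalRealSubfield L))
  haveI := Literature.NumberTheory.Automorphic.secondCountableTopology_finiteAdeleRing (↥(maximalRealSubfield L))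
  haveI := locallyCompactSpace_finiteAdeleRing' (↥(maximalRealSubfield L))
  haveI := locallyCompactSpace_adeleRing' (↥(maximalRealSubfield L))
  borelize (AdeleRing (𝓞 ↥(maximalRealSubfield L)) ↥(maximalRealSubfield L))
    (FiniteAdeleRing (𝓞 ↥(maximalRealSubfield L)) ↥(maximalRealSubfield L))
    ↥(UnitaryGroup.adelic (↥(maximalRealSubfield L)) L (IsCMField.complexConj L) N (Matrix.diagonal dV))
    ↥(UnitaryGroup.arch (↥(maximalRealSubfield L)) L (IsCMField.complexConj L) 1 (JW (↥(maximalRealSubfield L)) L a))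
    ↥(UnitaryGroup.finAdelic (↥(maximalRealSubfield L)) L (IsCMField.complexConj L) 1 (JW (↥(maximalRealSubfield L)) L a))
  haveI : BorelSpace (Fin n' → NumberField.mixedEmbedding.mixedSpace (↥(maximalRealSubfield L))) := Pi.borelSpace
  haveI : BorelSpace (Fin n' → FiniteAdeleRing (𝓞 ↥(maximalRealSubfield L)) ↥(maximalRealSubfield L)) := Pi.borelSpace
  haveI : BorelSpace (Fin n' → AdeleRing (𝓞 ↥(maximalRealSubfield L)) ↥(maximalRealSubfield L)) := Pi.borelSpace
  letI mW : MeasurableSpace ↥(UnitaryGroup.adelic (↥(maximalRealSubfield L)) L (IsCMField.complexConj L) 1 (JW (↥(maximalRealSubfield L)) L a)) :=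
    borel _
  haveI : BorelSpace ↥(UnitaryGroup.adelic (↥(maximalRealSubfield L)) L (IsCMField.complexConj L) 1 (JW (↥(maximalRealSubfield L)) L a)) := ⟨rfl⟩
  letI : MeasurableSpace (UnitaryGroup.adelicGroupData (↥(maximalRealSubfield L)) L (IsCMField.complexConj L) 1
      (JW (↥(maximalRealSubfield L)) L a)).Adelic := mW
  haveI : BorelSpace (UnitaryGroup.adelicGroupData (↥(maximalRealSubfield L)) L (IsCMField.complexConj L) 1
      (JW (↥(maximalRealSubfield L)) L a)).Adelic := ⟨rfl⟩
  haveI : LocallyCompactSpace ↥(UnitaryGroup.adelic (↥(maximalRealSubfield L)) L (IsCMField.complexConj L) N (Matrix.diagonal dV)) :=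
    UnitaryGroup.locallyCompactSpace_cmDatum_Adelic L N (Matrix.diagonal dV)
  haveI : SecondCountableTopology ↥(UnitaryGroup.adelic (↥(maximalRealSubfield L)) L (IsCMField.complexConj L) N (Matrix.diagonal dV)) :=
    UnitaryGroup.secondCountableTopology_cmDatum_Adelic L N (Matrix.diagonal dV)
  haveI : T2Space ↥(UnitaryGroup.adelic (↥(maximalRealSubfield L)) L (IsCMField.complexConj L) N (Matrix.diagonal dV)) :=
    UnitaryGroup.t2Space_cmDatum_Adelic L N (Matrix.diagonal dV)
  haveI : DiscreteTopology ↥(UnitaryGroup.toAdelic (↥(maximalRealSubfield L)) L (IsCMField.complexConj L) N (Matrix.diagonal dV)).range :=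
    UnitaryGroup.adelicGroupData_isDiscreteRational L N (Matrix.diagonal dV)
  have hVcl : IsClosed ((UnitaryGroup.toAdelic (↥(maximalRealSubfield L)) L (IsCMField.complexConj L) N (Matrix.diagonal dV)).range :
      Set ↥(UnitaryGroup.adelic (↥(maximalRealSubfield L)) L (IsCMField.complexConj L) N (Matrix.diagonal dV))) :=
    Subgroup.isClosed_of_discrete
  haveI : BorelSpace (↥(UnitaryGroup.adelic (↥(maximalRealSubfield L)) L (IsCMField.complexConj L) N (Matrix.diagonal dV)) ⧸
      (UnitaryGroup.toAdelic (↥(maximalRealSubfield L)) L (IsCMField.complexConj L) N (Matrix.diagonal dV)).range) := borelSpace_quotient _ hVcl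
  haveI : LocallyCompactSpace ↥(UnitaryGroup.adelic (↥(maximalRealSubfield L)) L (IsCMField.complexConj L) 1 (JW (↥(maximalRealSubfield L)) L a)) :=
    UnitaryGroup.locallyCompactSpace_cmDatum_Adelic L 1 (JW (↥(maximalRealSubfield L)) L a)
  haveI hca : CompactSpace ↥(UnitaryGroup.arch (↥(maximalRealSubfield L)) L (IsCMField.complexConj L) 1 (JW (↥(maximalRealSubfield L)) L a)) :=
    UnitaryGroup.compactSpace_arch_rankOne (↥(maximalRealSubfield L)) L (IsCMField.complexConj L) _ (complexConj_imagUnit L) (imagUnit_ne_zero L)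
      (isUnit_det_TW (↥(maximalRealSubfield L)) a) (JW_eq (↥(maximalRealSubfield L)) L a)
  -- (2) the measures
  set μE : Measure (Fin n' → NumberField.mixedEmbedding.mixedSpace (↥(maximalRealSubfield L))) := Measure.addHaar
  set μfX : Measure (Fin n' → FiniteAdeleRing (𝓞 ↥(maximalRealSubfield L)) ↥(maximalRealSubfield L)) := Measure.addHaar
  set νX : Measure (Fin n' → AdeleRing (𝓞 ↥(maximalRealSubfield L)) ↥(maximalRealSubfield L)) := Measure.addHaar
  obtain ⟨cX, hcX, hνX⟩ := exists_haar_eq_smul_map_prod (↥(maximalRealSubfield L)) (Fin n') νX μE μfX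
  set dh : Measure ↥(UnitaryGroup.adelic (↥(maximalRealSubfield L)) L (IsCMField.complexConj L) 1 (JW (↥(maximalRealSubfield L)) L a)) :=
    Measure.haar with hdh
  have hdhH : dh.IsHaarMeasure := by rw [hdh]; infer_instance
  haveI : @Measure.IsHaarMeasure (UnitaryGroup.adelicGroupData (↥(maximalRealSubfield L)) L (IsCMField.complexConj L) 1
      (JW (↥(maximalRealSubfield L)) L a)).Adelic _ _ _ dh := hdhH
  haveI := UnitaryGroup.isHaarMeasure_map_finPart (↥(maximalRealSubfield L)) L (IsCMField.complexConj L) 1 (JW (↥(maximalRealSubfield L)) L a) dh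
  -- (3) a finite invariant open-positive measure on `[U(diag dV)]`
  obtain ⟨ν, hνfin, hνpos, hνinv⟩ := exists_smulInvariantMeasure_quotient_range_toAdelic L dV hdV τ (Or.inl hτ)
  haveI := hνfin
  haveI := hνpos
  haveI := hνinv
  -- (4) RALLIS for the T5 datum (★ (N3))
  have hR := F0P2tLineRallisIdentity.rallisInnerProductIdentity_lineThetaKernelDatum L e₁ dV hdV hdV0 hN h3 μH hμ a ι₁ h₁V hV τ
    (posDef_diagonal_map_of_re_pos L dV hdV τ hτ) hρ νX dh μW ν
  -- (5) Liu's `χ` on the line: the finite character `χ_W = lineChar a χ`, continuous and unitary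
  have hχfc : Continuous fun b : UnitaryGroup.finAdelic (↥(maximalRealSubfield L)) L (IsCMField.complexConj L) 1 (JW (↥(maximalRealSubfield L)) L a) =>
      ((lineChar (↥(maximalRealSubfield L)) L (IsCMField.complexConj L) a χ.1 b : ℂˣ) : ℂ) :=
    Units.continuous_val.comp (continuous_lineChar (↥(maximalRealSubfield L)) L (IsCMField.complexConj L) a χ.2.1)
  have hχfu : ∀ b, ‖((lineChar (↥(maximalRealSubfield L)) L (IsCMField.complexConj L) a χ.1 b : ℂˣ) : ℂ)‖ = 1 :=
    fun b => norm_lineChar_apply_eq_one_cm L a χ b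
  -- (6) (N2): ONE non-zero finite Fourier coefficient at the `μ`-splitting, weight `conj χ_W`
  obtain ⟨Φf, hfin⟩ := F0P2tLineFinCoeff.exists_finCoeff_ne_zero_lineThetaKernelDatum L e₁ dV hdV hdV0 h3 μfX a
    (dh.map (UnitaryGroup.finPart (↥(maximalRealSubfield L)) L (IsCMField.complexConj L) 1 (JW (↥(maximalRealSubfield L)) L a))) μH hμ
    (lineChar (↥(maximalRealSubfield L)) L (IsCMField.complexConj L) a χ.1) hχfc hχfu
  -- (7) the archimedean rows: `Φ_∞` is FIXED (eigencharacter `1 = χ̃_∞`), `⟨Φ_∞, Φ_∞⟩_∞ ≠ 0`, and the `∞ ⊔ f` reading of `χ̃`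
  have hχu : ∀ a' : UnitaryGroup.arch (↥(maximalRealSubfield L)) L (IsCMField.complexConj L) 1 (JW (↥(maximalRealSubfield L)) L a),
      (fun _ : UnitaryGroup.arch (↥(maximalRealSubfield L)) L (IsCMField.complexConj L) 1 (JW (↥(maximalRealSubfield L)) L a) => (1 : ℂ)) a' *
        conj ((fun _ : UnitaryGroup.arch (↥(maximalRealSubfield L)) L (IsCMField.complexConj L) 1 (JW (↥(maximalRealSubfield L)) L a) => (1 : ℂ)) a') = 1 :=
    fun _ => by rw [map_one, mul_one]
  have heig : ∀ a' : UnitaryGroup.arch (↥(maximalRealSubfield L)) L (IsCMField.complexConj L) 1 (JW (↥(maximalRealSubfield L)) L a),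
      HodgeCM.Model.HypCensus.archWeilRep (↥(maximalRealSubfield L)) L (IsCMField.complexConj L) N 1 (Matrix.diagonal dV)
        (JW (↥(maximalRealSubfield L)) L a) (complexConj_imagUnit L) (imagUnit_ne_zero L) (imagUnit_mul_self L) (realDiagonal_isSymm L dV hdV)
        (isSymm_TW (↥(maximalRealSubfield L)) a) (isUnit_det_realDiagonal L dV hdV hdV0) (isUnit_det_TW (↥(maximalRealSubfield L)) a)
        (realDiagonal_map L dV hdV).symm (JW_eq (↥(maximalRealSubfield L)) L a) e₁
        (chiSplittingLine L e₁ dV hdV hdV0 (toHeckeCharacter L μH) (isUnitary_toHeckeCharacter L μH)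
          ((isOscillatorChar_toHeckeCharacter_iff μH).mpr hμ) (TW (↥(maximalRealSubfield L)) a)
          (isUnit_det_TW (↥(maximalRealSubfield L)) a) (JW (↥(maximalRealSubfield L)) L a) (JW_eq (↥(maximalRealSubfield L)) L a))
        (ThetaNonvanishing.proj_apply_eq_toSp (↥(maximalRealSubfield L)) L (IsCMField.complexConj L) N 1 e₁ (Matrix.diagonal dV)
          (JW (↥(maximalRealSubfield L)) L a) (complexConj_imagUnit L) (imagUnit_ne_zero L) (imagUnit_mul_self L) (realDiagonal_isSymm L dV hdV)
          (isSymm_TW (↥(maximalRealSubfield L)) a) (isUnit_det_realDiagonal L dV hdV hdV0) (isUnit_det_TW (↥(maximalRealSubfield L)) a)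
          (realDiagonal_map L dV hdV).symm (JW_eq (↥(maximalRealSubfield L)) L a)
          (isCompatible_chiSplittingLine L e₁ dV hdV hdV0 (toHeckeCharacter L μH) (isUnitary_toHeckeCharacter L μH)
            ((isOscillatorChar_toHeckeCharacter_iff μH).mpr hμ) (TW (↥(maximalRealSubfield L)) a) (isSymm_TW (↥(maximalRealSubfield L)) a)
            (isUnit_det_TW (↥(maximalRealSubfield L)) a) (JW (↥(maximalRealSubfield L)) L a) (JW_eq (↥(maximalRealSubfield L)) L a)))
        (1, a') Φinf =
        (fun _ : UnitaryGroup.arch (↥(maximalRealSubfield L)) L (IsCMField.complexConj L) 1 (JW (↥(maximalRealSubfield L)) L a) => (1 : ℂ)) a' • Φinf :=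
    fun a' => by rw [hE a', one_smul]
  have hΦΦ := integral_mul_conj_ne_zero_of_ne_zero' μE Φinf hΦ
  have hχw := conj_coe_chiQuot_mk (↥(maximalRealSubfield L)) L (IsCMField.complexConj L) (Algebra.IsQuadraticExtension.finrank_eq_two _ L)
    (IsCMField.complexConj_ne_one (K := L)) a χ
  -- (8) BRICK 7 at the `μ`-splitting of the line
  exact ⟨Φf, (ThetaNonvanishing.thetaLift_charCM_tmul_ne_zero_of_finCoeff_ne_zero (↥(maximalRealSubfield L)) L (IsCMField.complexConj L) N 1 e₁
    (Matrix.diagonal dV) (JW (↥(maximalRealSubfield L)) L a) (complexConj_imagUnit L) (imagUnit_ne_zero L) (imagUnit_mul_self L)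
    (realDiagonal_isSymm L dV hdV) (isSymm_TW (↥(maximalRealSubfield L)) a) (isUnit_det_realDiagonal L dV hdV hdV0)
    (isUnit_det_TW (↥(maximalRealSubfield L)) a) (realDiagonal_map L dV hdV).symm (JW_eq (↥(maximalRealSubfield L)) L a)
    (isCompatible_chiSplittingLine L e₁ dV hdV hdV0 (toHeckeCharacter L μH) (isUnitary_toHeckeCharacter L μH)
      ((isOscillatorChar_toHeckeCharacter_iff μH).mpr hμ) (TW (↥(maximalRealSubfield L)) a) (isSymm_TW (↥(maximalRealSubfield L)) a)
      (isUnit_det_TW (↥(maximalRealSubfield L)) a) (JW (↥(maximalRealSubfield L)) L a) (JW_eq (↥(maximalRealSubfield L)) L a))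
    dh Measure.haar (dh.map (UnitaryGroup.finPart (↥(maximalRealSubfield L)) L (IsCMField.complexConj L) 1 (JW (↥(maximalRealSubfield L)) L a)))
    hρ Set.univ (fun _ _ _ => Set.mem_univ _) _ ν hνX hcX.ne' hR _ hχu hχw heig hΦΦ hfin).1⟩

/-! ## §3 The junction's currency (★ `F0P2sThetaOccursInOfArch`, hypothesis `hN`): a non-zero theta pair read on `U(H)(𝔸_{L⁺})` through `ι_A` -/

set_option synthInstance.maxHeartbeats 400000 in
set_option maxHeartbeats 8000000 in
include hN h3 ι₁ h₁V hV τ hτ in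
/-- **THE (N)-HALF READ ON `U(H)(𝔸_{L⁺})`**: for a CM frame `(H, g, hg)` over `diag d_V` and an arch-fixed `Φ_∞ ≠ 0` as in (E), some finite `Φ_f` and some
`x ∈ U(H)(𝔸_{L⁺})` have `Θ̃_{Φ_∞ ⊗ Φ_f}(charCM χ̃_χ)(ι_A x) ≠ 0` (the lift read on the group through the frame transport, as in ★ `MeetsThetaLiftFromLine`).
[cite: Liu2021, proof of Prop. 4.13 (p. 49 «Conversely», l. 2145)] [cite: Li1992, Thm 2.1 (26)–(27) p. 184; §5] [cite: FleigEtAl2018, §12.3 Def. 12.5 (12.37)] -/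
theorem exists_lineThetaLiftFun_ne_zero_of_archFixed (H : Matrix (Fin N) (Fin N) L) (g : GL (Fin N) L)
    (hg : ((g : Matrix (Fin N) (Fin N) L).map (cmConjRingHom L))ᵀ * H * (g : Matrix (Fin N) (Fin N) L) = Matrix.diagonal dV)
    {Φinf : 𝓢((Fin n' → NumberField.mixedEmbedding.mixedSpace (↥(maximalRealSubfield L))), ℂ)} (hΦ : Φinf ≠ 0)
    (hE : ∀ a' : UnitaryGroup.arch (↥(maximalRealSubfield L)) L (IsCMField.complexConj L) 1 (JW (↥(maximalRealSubfield L)) L a),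
      HodgeCM.Model.HypCensus.archWeilRep (↥(maximalRealSubfield L)) L (IsCMField.complexConj L) N 1 (Matrix.diagonal dV)
        (JW (↥(maximalRealSubfield L)) L a) (complexConj_imagUnit L) (imagUnit_ne_zero L) (imagUnit_mul_self L) (realDiagonal_isSymm L dV hdV)
        (isSymm_TW (↥(maximalRealSubfield L)) a) (isUnit_det_realDiagonal L dV hdV hdV0) (isUnit_det_TW (↥(maximalRealSubfield L)) a)
        (realDiagonal_map L dV hdV).symm (JW_eq (↥(maximalRealSubfield L)) L a) e₁
        (chiSplittingLine L e₁ dV hdV hdV0 (toHeckeCharacter L μH) (isUnitary_toHeckeCharacter L μH)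
          ((isOscillatorChar_toHeckeCharacter_iff μH).mpr hμ) (TW (↥(maximalRealSubfield L)) a)
          (isUnit_det_TW (↥(maximalRealSubfield L)) a) (JW (↥(maximalRealSubfield L)) L a) (JW_eq (↥(maximalRealSubfield L)) L a))
        (ThetaNonvanishing.proj_apply_eq_toSp (↥(maximalRealSubfield L)) L (IsCMField.complexConj L) N 1 e₁ (Matrix.diagonal dV)
          (JW (↥(maximalRealSubfield L)) L a) (complexConj_imagUnit L) (imagUnit_ne_zero L) (imagUnit_mul_self L) (realDiagonal_isSymm L dV hdV)
          (isSymm_TW (↥(maximalRealSubfield L)) a) (isUnit_det_realDiagonal L dV hdV hdV0) (isUnit_det_TW (↥(maximalRealSubfield L)) a)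
          (realDiagonal_map L dV hdV).symm (JW_eq (↥(maximalRealSubfield L)) L a)
          (isCompatible_chiSplittingLine L e₁ dV hdV hdV0 (toHeckeCharacter L μH) (isUnitary_toHeckeCharacter L μH)
            ((isOscillatorChar_toHeckeCharacter_iff μH).mpr hμ) (TW (↥(maximalRealSubfield L)) a) (isSymm_TW (↥(maximalRealSubfield L)) a)
            (isUnit_det_TW (↥(maximalRealSubfield L)) a) (JW (↥(maximalRealSubfield L)) L a) (JW_eq (↥(maximalRealSubfield L)) L a)))
        (1, a') Φinf = Φinf) :
    ∃ (Φf : FinSB (↥(maximalRealSubfield L)) (Fin n')) (x : (adelicGroupData (↥(maximalRealSubfield L)) L (IsCMField.complexConj L) N H).Adelic),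
      (lineThetaKernelDatum L N e₁ dV hdV hdV0 μH hμ a hρ).thetaLiftFun μW
          (piSchwartzBruhatEquiv (↥(maximalRealSubfield L)) (Fin n') (Φinf ⊗ₜ[ℂ] Φf))
          (charCM (chiQuot (↥(maximalRealSubfield L)) L (IsCMField.complexConj L) (Algebra.IsQuadraticExtension.finrank_eq_two _ L)
            (IsCMField.complexConj_ne_one (K := L)) a χ))
          (cmAdelicFrameTransport L N H dV g hg x) ≠ 0 := by
  obtain ⟨Φf, hne⟩ := lineThetaLift_tmul_charCM_chiQuot_ne_zero_of_archFixed L e₁ dV hdV hdV0 hN h3 μH hμ a ι₁ h₁V hV τ hτ hρ μW χ hΦ hE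
  obtain ⟨q, hq⟩ := DFunLike.ne_iff.mp hne
  obtain ⟨y, rfl⟩ := QuotientGroup.mk_surjective q
  obtain ⟨x, hx⟩ := cmAdelicFrameTransport_surjective L dV H g hg y⁻¹
  refine ⟨Φf, x, ?_⟩
  rw [ThetaKernelDatum.thetaLiftFun_apply, hx, inv_inv]
  exact hq

set_option synthInstance.maxHeartbeats 400000 in
set_option maxHeartbeats 8000000 in
include hN h3 ι₁ h₁V hV τ hτ in
/-- **THE HYPOTHESIS `hN` OF ★ `F0P2sThetaOccursInOfArch.exists_ne_zero_forall_mem_cohForms_thetaFunIntertwiner_of_{hol,antihol}_arch`, PRODUCED**: for a pair of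
archimedean Schwartz vectors `φ₀, φ₁` on `(L⁺ ⊗ ℝ)^{N×1}`, if one of them, `φ_{j₀}`, re-indexed to `(L⁺ ⊗ ℝ)^{n'}` by `R_{e₁}^∞` (★ `schwartzReindexCLM`), is non-zero and
`U(⟨a⟩)(L⁺ ⊗ ℝ)`-fixed under `archWeilRep` at the `μ`-splitting (E), then for some finite `Φ_f ∈ 𝒮((𝔸_{L⁺,f})^{N×1})` the THETA PAIR
`(x, j) ↦ Θ̃_{R_{e₁}(φ_j ⊗ Φ_f)}(charCM χ̃_χ)(ι_A x)` is a non-zero function on `U(H)(𝔸_{L⁺}) × Fin 2` (★ `piSBReindex_tmul`).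
[cite: Liu2021, proof of Prop. 4.13 (p. 49 «Conversely», l. 2145); App. D §D.1 Step 3] [cite: Li1992, Thm 2.1 (26)–(27) p. 184; §5] -/
theorem thetaPair_ne_zero_of_archFixed (H : Matrix (Fin N) (Fin N) L) (g : GL (Fin N) L)
    (hg : ((g : Matrix (Fin N) (Fin N) L).map (cmConjRingHom L))ᵀ * H * (g : Matrix (Fin N) (Fin N) L) = Matrix.diagonal dV)
    (φ : Fin 2 → 𝓢(((Fin N × Fin 1) → NumberField.mixedEmbedding.mixedSpace (↥(maximalRealSubfield L))), ℂ)) (j₀ : Fin 2)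
    (hΦ : schwartzReindexCLM (↥(maximalRealSubfield L)) e₁ (φ j₀) ≠ 0)
    (hE : ∀ a' : UnitaryGroup.arch (↥(maximalRealSubfield L)) L (IsCMField.complexConj L) 1 (JW (↥(maximalRealSubfield L)) L a),
      HodgeCM.Model.HypCensus.archWeilRep (↥(maximalRealSubfield L)) L (IsCMField.complexConj L) N 1 (Matrix.diagonal dV)
        (JW (↥(maximalRealSubfield L)) L a) (complexConj_imagUnit L) (imagUnit_ne_zero L) (imagUnit_mul_self L) (realDiagonal_isSymm L dV hdV)
        (isSymm_TW (↥(maximalRealSubfield L)) a) (isUnit_det_realDiagonal L dV hdV hdV0) (isUnit_det_TW (↥(maximalRealSubfield L)) a)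
        (realDiagonal_map L dV hdV).symm (JW_eq (↥(maximalRealSubfield L)) L a) e₁
        (chiSplittingLine L e₁ dV hdV hdV0 (toHeckeCharacter L μH) (isUnitary_toHeckeCharacter L μH)
          ((isOscillatorChar_toHeckeCharacter_iff μH).mpr hμ) (TW (↥(maximalRealSubfield L)) a)
          (isUnit_det_TW (↥(maximalRealSubfield L)) a) (JW (↥(maximalRealSubfield L)) L a) (JW_eq (↥(maximalRealSubfield L)) L a))
        (ThetaNonvanishing.proj_apply_eq_toSp (↥(maximalRealSubfield L)) L (IsCMField.complexConj L) N 1 e₁ (Matrix.diagonal dV)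
          (JW (↥(maximalRealSubfield L)) L a) (complexConj_imagUnit L) (imagUnit_ne_zero L) (imagUnit_mul_self L) (realDiagonal_isSymm L dV hdV)
          (isSymm_TW (↥(maximalRealSubfield L)) a) (isUnit_det_realDiagonal L dV hdV hdV0) (isUnit_det_TW (↥(maximalRealSubfield L)) a)
          (realDiagonal_map L dV hdV).symm (JW_eq (↥(maximalRealSubfield L)) L a)
          (isCompatible_chiSplittingLine L e₁ dV hdV hdV0 (toHeckeCharacter L μH) (isUnitary_toHeckeCharacter L μH)
            ((isOscillatorChar_toHeckeCharacter_iff μH).mpr hμ) (TW (↥(maximalRealSubfield L)) a) (isSymm_TW (↥(maximalRealSubfield L)) a)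
            (isUnit_det_TW (↥(maximalRealSubfield L)) a) (JW (↥(maximalRealSubfield L)) L a) (JW_eq (↥(maximalRealSubfield L)) L a)))
        (1, a') (schwartzReindexCLM (↥(maximalRealSubfield L)) e₁ (φ j₀)) = schwartzReindexCLM (↥(maximalRealSubfield L)) e₁ (φ j₀)) :
    ∃ Φf : FinSB (↥(maximalRealSubfield L)) (Fin N × Fin 1),
      (fun (x : (adelicGroupData (↥(maximalRealSubfield L)) L (IsCMField.complexConj L) N H).Adelic) (j : Fin 2) =>
        (lineThetaKernelDatum L N e₁ dV hdV hdV0 μH hμ a hρ).thetaLiftFun μW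
          (piSBReindex (↥(maximalRealSubfield L)) e₁
            (piSchwartzBruhatEquiv (↥(maximalRealSubfield L)) (Fin N × Fin 1) (φ j ⊗ₜ[ℂ] Φf)))
          (charCM (chiQuot (↥(maximalRealSubfield L)) L (IsCMField.complexConj L) (Algebra.IsQuadraticExtension.finrank_eq_two _ L)
            (IsCMField.complexConj_ne_one (K := L)) a χ))
          (cmAdelicFrameTransport L N H dV g hg x)) ≠ 0 := by
  obtain ⟨Φfin, x, hx⟩ := exists_lineThetaLiftFun_ne_zero_of_archFixed L e₁ dV hdV hdV0 hN h3 μH hμ a ι₁ h₁V hV τ hτ hρ μW χ H g hg hΦ hE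
  refine ⟨(finSBReindex (↥(maximalRealSubfield L)) e₁).symm Φfin, fun h0 => hx ?_⟩
  have h1 := congrFun (congrFun h0 x) j₀
  rw [piSBReindex_tmul, LinearEquiv.apply_symm_apply] at h1
  exact h1

end Summit.HodgeConjecture.HodgeConjecture.Cruxes.H413.F0P2tLineThetaLiftNeZeroOfArchFixed

end
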